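import Mathlib
import Literature.Barriers.MatrixMultiplication.NormalizerBarrier
import Summits.MatrixMultiplication.MatrixMultiplication.Theorems.LieRankDesigns.Negative.Basics
import Summits.MatrixMultiplication.MatrixMultiplication.Theorems.SubgroupIdentityDesigns.Negative.DecoratedSylowShapes
import Summits.MatrixMultiplication.MatrixMultiplication.Theorems.SubgroupIdentityDesigns.Negative.NormOneTorus
import Summits.MatrixMultiplication.MatrixMultiplication.Theorems.SubgroupIdentityDesigns.Negative.SingerCycle
import Summits.MatrixMultiplication.MatrixMultiplication.Theorems.SubgroupIdentityDesigns.Negative.ScalarLaw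
import Summits.MatrixMultiplication.MatrixMultiplication.Theorems.SubgroupIdentityDesigns.Negative.WitnessFreeVector
import Summits.MatrixMultiplication.MatrixMultiplication.Theorems.SubgroupIdentityDesigns.Negative.FullImageSplit

/-!
# FULL non-split-torus-normaliser image ⇒ every vector has a fixer; consequences for witnesses

Route `LevelGradedCohnUmans`, crux `SubgroupIdentityDesigns` (stmt-MatrixMultiplication-14079),
negative side, cell `(m,k) = (2,1)`, all odd `p`.  Companion of `FullImageSplit`.

* `fixers_of_full_nonsplit` — **non-split torus** (`n` a non-square, `C = {[[a, nb],[b, a]]}` the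
  Singer torus, `N(C) = C ∪ σC`, `σ = diag(1,-1)`): if `H Z ⊇ N(C)` (every element of `N(C)` has a
  scalar multiple in `H`) then every non-zero vector is fixed by a non-identity element of `H`:
  a non-square scalar in `S = H ∩ Z` comes from `j = [[0, n], [1, 0]] ∈ C` (`j² = n·1`), so the
  index of `S` in `𝔽_pˣ` is odd (`FullImageSplit.units_mem_of_sq_mem`); hence `σ ∈ H` (`σ² = 1`)
  and the whole norm-one torus `T₁ ⊆ H` (`t · (σ t σ) = det t · 1`); finally for `v ≠ 0` the
  element `t = M(σv) M(v)⁻¹ ∈ T₁` has `σ t v = v`, `σ t ≠ 1`.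
* `no_levelOne_witness_of_full_split` / `no_levelOne_witness_of_full_nonsplit` — combined with
  `WitnessFreeVector`: no member of a `(2,1)` level-one witness (`0 < ε ≤ 1`, `p ≥ 3`) has full
  split- or non-split-torus-normaliser image.

With Dickson's classification of the `p`-free subgroups of `GL₂(𝔽_p)` (paper) this leaves, for
`p ≥ 61`, only members of projective image `≤ p + 1`, excluded for `ε ≤ 0.98` by `ImageCeiling`.
VALUE = THEOREM (all odd `p`), NOT summit progress; the crux item is untouched and remains open.
Report: `run/shared/lean/b2b/levelgraded-cu/ORACLE-g16.md` §G16-2.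
-/

set_option linter.dupNamespace false

noncomputable section

open scoped Classical
open Summit.MatrixMultiplication.MatrixMultiplication.Theorems.LieRankDesigns.Negative (GLm Mat budget)
open Literature.Barriers.MatrixMultiplication (SubgroupTPP)

namespace Summit.MatrixMultiplication.MatrixMultiplication.Theorems.SubgroupIdentityDesigns.Negative

section FullImage

variable {p : ℕ} [hp : Fact p.Prime]

/-! ### Non-split torus: full image of the Singer normaliser -/

/-- **Full non-split image ⇒ no free vector.**  `p` odd, `n` a non-square, `C = {[[a, nb],[b, a]]}`
the Singer torus, `σ C` (`σ = diag(1,-1)`) the other coset of its normaliser.  If for every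
`g ∈ C ∪ σ C` some scalar multiple `g · λ` lies in `H`, then every non-zero vector is fixed by some
`h ∈ H`, `h ≠ 1`. -/
theorem fixers_of_full_nonsplit (hp2 : p ≠ 2) {n : ZMod p} (hn : ∀ x : ZMod p, x * x ≠ n)
    {H : Subgroup (GLm p 2)}
    (hfull : ∀ g : GLm p 2,
      (((g : Mat p 2) 0 1 = n * (g : Mat p 2) 1 0 ∧ (g : Mat p 2) 1 1 = (g : Mat p 2) 0 0) ∨
        ((g : Mat p 2) 0 1 = -(n * (g : Mat p 2) 1 0) ∧
          (g : Mat p 2) 1 1 = -(g : Mat p 2) 0 0)) →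
      ∃ u : (ZMod p)ˣ, g * scalarHom p 2 u ∈ H) :
    ∀ a : Fin 2 → ZMod p, a ≠ 0 →
      ∃ h ∈ H, h ≠ 1 ∧ ((h : GLm p 2) : Mat p 2).mulVec a = a := by
  have hsc := fun u : (ZMod p)ˣ => scalarHom_entries (p := p) u
  have o := gl2_one_apply (p := p)
  have hn0 : n ≠ 0 := fun h => hn 0 (by rw [h, mul_zero])
  set ν : (ZMod p)ˣ := Units.mk0 n hn0 with hνdef
  have hνv : ((ν : (ZMod p)ˣ) : ZMod p) = n := rfl
  have hν : ¬ IsSquare ν := by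
    rintro ⟨r, hr⟩
    apply hn (r : ZMod p)
    have := congrArg (fun x : (ZMod p)ˣ => (x : ZMod p)) hr
    simp only [Units.val_mul] at this
    rw [hνv] at this
    exact this.symm
  -- (1) a non-square scalar in H via j = [[0, n], [1, 0]] ∈ C, j² = n·1
  obtain ⟨j, j00, j01, j10, j11⟩ := exists_gl2 (p := p) 0 n 1 0
    (by rw [zero_mul, zero_sub, neg_ne_zero, mul_one]; exact hn0)
  have hj2 : j * j = scalarHom p 2 ν := by
    obtain ⟨c00, c01, c10, c11⟩ := hsc ν
    apply gl2_ext <;> simp only [gl2_mul_apply, j00, j01, j10, j11, c00, c01, c10, c11, hνv] <;>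
      ring
  obtain ⟨u₀, hu₀⟩ := hfull j (Or.inl ⟨by rw [j01, j10, mul_one], by rw [j11, j00]⟩)
  have hS₀ : scalarHom p 2 (ν * u₀ ^ 2) ∈ H := scalar_sq_mem_of_mul_mem hj2 hu₀
  have hns : ¬ IsSquare (ν * u₀ ^ 2) := by
    rintro ⟨r, hr⟩
    exact hν ⟨r * u₀⁻¹, by
      have : ν = r * r * (u₀ ^ 2)⁻¹ := by rw [← hr, mul_inv_cancel_right]
      rw [this, sq, mul_inv, mul_mul_mul_comm]⟩
  have hpar : ∀ μ : (ZMod p)ˣ, scalarHom p 2 (μ ^ 2) ∈ H → scalarHom p 2 μ ∈ H := by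
    intro μ hμ
    have := units_mem_of_sq_mem hp2 (H.comap (scalarHom p 2)) (s₀ := ν * u₀ ^ 2)
      (by rw [Subgroup.mem_comap]; exact hS₀) hns (μ := μ) (by rw [Subgroup.mem_comap]; exact hμ)
    rwa [Subgroup.mem_comap] at this
  -- (2) σ = diag(1,-1) ∈ H
  obtain ⟨σ, σ00, σ01, σ10, σ11⟩ := exists_gl2 (p := p) 1 0 0 (-1)
    (by rw [zero_mul, sub_zero, one_mul, neg_ne_zero]; exact one_ne_zero)
  have hσ2 : σ * σ = 1 := by
    obtain ⟨o00, o01, o10, o11⟩ := o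
    apply gl2_ext <;> simp only [gl2_mul_apply, σ00, σ01, σ10, σ11, o00, o01, o10, o11] <;> ring
  obtain ⟨u₁, hu₁⟩ := hfull σ (Or.inr ⟨by rw [σ01, σ10, mul_zero, neg_zero], by rw [σ11, σ00]⟩)
  have hσH : σ ∈ H := mem_of_mul_scalar_mem_of_sq_one hpar hσ2 hu₁
  -- (3) the norm-one torus lies in H
  have ht1 : ∀ t : GLm p 2, (t : Mat p 2) 0 1 = n * (t : Mat p 2) 1 0 →
      (t : Mat p 2) 1 1 = (t : Mat p 2) 0 0 →
      (t : Mat p 2) 0 0 * (t : Mat p 2) 0 0 - n * ((t : Mat p 2) 1 0 * (t : Mat p 2) 1 0) = 1 →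
      t ∈ H := by
    intro t t01 t11 hdet
    obtain ⟨u, hu⟩ := hfull t (Or.inl ⟨t01, t11⟩)
    -- t * (σ t σ) = 1 (norm one)
    have htt : t * (σ * t * σ) = 1 := by
      obtain ⟨o00, o01, o10, o11⟩ := o
      apply gl2_ext <;> simp only [gl2_mul_apply, σ00, σ01, σ10, σ11, t01, t11, o00, o01, o10, o11]
      · linear_combination hdet
      · ring
      · ring
      · linear_combination hdet
    have hconjH : σ * (t * scalarHom p 2 u) * σ ∈ H := H.mul_mem (H.mul_mem hσH hu) hσH
    have hL1 : σ * (t * scalarHom p 2 u) * σ = σ * t * σ * scalarHom p 2 u := by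
      calc σ * (t * scalarHom p 2 u) * σ = σ * t * (scalarHom p 2 u * σ) := by
            simp only [mul_assoc]
        _ = σ * t * (σ * scalarHom p 2 u) := by rw [scalarHom_comm u σ]
        _ = σ * t * σ * scalarHom p 2 u := by simp only [mul_assoc]
    have hprod : t * scalarHom p 2 u * (σ * (t * scalarHom p 2 u) * σ) = scalarHom p 2 (u ^ 2) := by
      rw [hL1]
      calc t * scalarHom p 2 u * (σ * t * σ * scalarHom p 2 u)
          = t * (scalarHom p 2 u * (σ * t * σ)) * scalarHom p 2 u := by simp only [mul_assoc]
        _ = t * ((σ * t * σ) * scalarHom p 2 u) * scalarHom p 2 u := by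
            rw [scalarHom_comm u (σ * t * σ)]
        _ = (t * (σ * t * σ)) * (scalarHom p 2 u * scalarHom p 2 u) := by simp only [mul_assoc]
        _ = scalarHom p 2 (u ^ 2) := by rw [htt, one_mul, map_pow, sq]
    have hu2 : scalarHom p 2 (u ^ 2) ∈ H := by rw [← hprod]; exact H.mul_mem hu hconjH
    have huH := hpar u hu2
    have := H.mul_mem hu (H.inv_mem huH)
    rwa [mul_inv_cancel_right] at this
  -- (4) conclusion: for a ≠ 0, t := M(σa) M(a)⁻¹ ∈ T₁ and σ t fixes a
  intro a ha
  have hQ : a 0 * a 0 - n * (a 1 * a 1) ≠ 0 := normForm_ne_zero hn ha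
  set Q := a 0 * a 0 - n * (a 1 * a 1) with hQdef
  set A := (a 0 * a 0 + n * (a 1 * a 1)) / Q with hA
  set B := -(2 * a 0 * a 1) / Q with hB
  have hN1 : A * A - n * (B * B) = 1 := by
    rw [hA, hB]; field_simp; ring
  obtain ⟨t, t00, t01, t10, t11⟩ := exists_gl2 (p := p) A (n * B) B A
    (by rw [show A * A - n * B * B = A * A - n * (B * B) by ring, hN1]; exact one_ne_zero)
  have htH : t ∈ H := ht1 t (by rw [t01, t10]) (by rw [t11, t00]) (by rw [t00, t10]; exact hN1)
  refine ⟨σ * t, H.mul_mem hσH htH, ?_, ?_⟩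
  · intro h
    have e00 := congrArg (fun x : GLm p 2 => (x : Mat p 2) 0 0) h
    have e11 := congrArg (fun x : GLm p 2 => (x : Mat p 2) 1 1) h
    simp only [gl2_mul_apply, σ00, σ01, σ10, σ11, t00, t01, t10, t11] at e00 e11
    rw [o.1] at e00
    rw [o.2.2.2] at e11
    apply one_ne_neg_one (p := p) hp2
    linear_combination -e00 - e11
  · funext i
    fin_cases i
    · show ((σ * t : GLm p 2) : Mat p 2).mulVec a 0 = a 0
      rw [mulVec_two_apply_zero, gl2_mul_apply, gl2_mul_apply, σ00, σ01, t00, t01, t10, t11, hA, hB]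
      field_simp
      ring
    · show ((σ * t : GLm p 2) : Mat p 2).mulVec a 1 = a 1
      rw [mulVec_two_apply_one, gl2_mul_apply, gl2_mul_apply, σ10, σ11, t00, t01, t10, t11, hA, hB]
      field_simp
      ring

/-! ### Consequence for level-one witnesses -/

/-- **No member of a `(2,1)` level-one witness has full split-torus-normaliser image**
(`0 < ε ≤ 1`, `p ≥ 3`): such a member has no free vector, contradicting `WitnessFreeVector`. -/
theorem no_levelOne_witness_of_full_split (hp3 : 3 ≤ p) {ε : ℝ} (hε : 0 < ε) (hε1 : ε ≤ 1)
    {H₁ H₂ H₃ : Subgroup (GLm p 2)} (htpp : SubgroupTPP H₁ H₂ H₃)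
    (hdesign : ∃ c : Mat p 2 → ℂ, (∀ M, 1 < M.rank → c M = 0) ∧
      (∑ M, c M * ZMod.stdAddChar (Matrix.trace (M * ((1 : GLm p 2) : Mat p 2)))) = 1 ∧
      ∀ a ∈ H₁, ∀ b ∈ H₂, ∀ g ∈ H₃, a * b * g ≠ 1 →
        (∑ M, c M *
          ZMod.stdAddChar (Matrix.trace (M * ((a * b * g : GLm p 2) : Mat p 2)))) = 0)
    (hfull : ∃ H ∈ ({H₁, H₂, H₃} : Set (Subgroup (GLm p 2))), ∀ g : GLm p 2,
      (((g : Mat p 2) 0 1 = 0 ∧ (g : Mat p 2) 1 0 = 0) ∨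
        ((g : Mat p 2) 0 0 = 0 ∧ (g : Mat p 2) 1 1 = 0)) →
      ∃ u : (ZMod p)ˣ, g * scalarHom p 2 u ∈ H) :
    ¬ budget p 2 1 (2 + ε) <
      ((Nat.card H₁ * Nat.card H₂ * Nat.card H₃ : ℕ) : ℝ) ^ ((2 + ε) / 3) := by
  intro hwit
  have hp2 : p ≠ 2 := by omega
  obtain ⟨hf₁, hf₂, hf₃⟩ := levelOne_witness_free_vector hp3 hε hε1 htpp hdesign hwit
  obtain ⟨H, hH, hfullH⟩ := hfull
  have key : ¬ ∃ a : Fin 2 → ZMod p, a ≠ 0 ∧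
      ∀ h ∈ H, ((h : GLm p 2) : Mat p 2).mulVec a = a → h = 1 := by
    rintro ⟨a, ha, hfree⟩
    obtain ⟨h, hh, hne, hfix⟩ := fixers_of_full_split hp2 hfullH a ha
    exact hne (hfree h hh hfix)
  simp only [Set.mem_insert_iff, Set.mem_singleton_iff] at hH
  rcases hH with rfl | rfl | rfl
  · exact key hf₁
  · exact key hf₂
  · exact key hf₃

/-- **No member of a `(2,1)` level-one witness has full non-split-torus-normaliser image**
(`0 < ε ≤ 1`, `p ≥ 3`, `n` any non-square). -/
theorem no_levelOne_witness_of_full_nonsplit (hp3 : 3 ≤ p) {ε : ℝ} (hε : 0 < ε) (hε1 : ε ≤ 1)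
    {n : ZMod p} (hn : ∀ x : ZMod p, x * x ≠ n)
    {H₁ H₂ H₃ : Subgroup (GLm p 2)} (htpp : SubgroupTPP H₁ H₂ H₃)
    (hdesign : ∃ c : Mat p 2 → ℂ, (∀ M, 1 < M.rank → c M = 0) ∧
      (∑ M, c M * ZMod.stdAddChar (Matrix.trace (M * ((1 : GLm p 2) : Mat p 2)))) = 1 ∧
      ∀ a ∈ H₁, ∀ b ∈ H₂, ∀ g ∈ H₃, a * b * g ≠ 1 →
        (∑ M, c M *
          ZMod.stdAddChar (Matrix.trace (M * ((a * b * g : GLm p 2) : Mat p 2)))) = 0)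
    (hfull : ∃ H ∈ ({H₁, H₂, H₃} : Set (Subgroup (GLm p 2))), ∀ g : GLm p 2,
      (((g : Mat p 2) 0 1 = n * (g : Mat p 2) 1 0 ∧ (g : Mat p 2) 1 1 = (g : Mat p 2) 0 0) ∨
        ((g : Mat p 2) 0 1 = -(n * (g : Mat p 2) 1 0) ∧
          (g : Mat p 2) 1 1 = -(g : Mat p 2) 0 0)) →
      ∃ u : (ZMod p)ˣ, g * scalarHom p 2 u ∈ H) :
    ¬ budget p 2 1 (2 + ε) <
      ((Nat.card H₁ * Nat.card H₂ * Nat.card H₃ : ℕ) : ℝ) ^ ((2 + ε) / 3) := by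
  intro hwit
  have hp2 : p ≠ 2 := by omega
  obtain ⟨hf₁, hf₂, hf₃⟩ := levelOne_witness_free_vector hp3 hε hε1 htpp hdesign hwit
  obtain ⟨H, hH, hfullH⟩ := hfull
  have key : ¬ ∃ a : Fin 2 → ZMod p, a ≠ 0 ∧
      ∀ h ∈ H, ((h : GLm p 2) : Mat p 2).mulVec a = a → h = 1 := by
    rintro ⟨a, ha, hfree⟩
    obtain ⟨h, hh, hne, hfix⟩ := fixers_of_full_nonsplit hp2 hn hfullH a ha
    exact hne (hfree h hh hfix)
  simp only [Set.mem_insert_iff, Set.mem_singleton_iff] at hH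
  rcases hH with rfl | rfl | rfl
  · exact key hf₁
  · exact key hf₂
  · exact key hf₃

end FullImage

end Summit.MatrixMultiplication.MatrixMultiplication.Theorems.SubgroupIdentityDesigns.Negative

end
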